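import Mathlib
import Summits.KontsevichZagierPeriods.KontsevichZagierPeriods.Theorems.IsogenyCertificatesRichelotChainSheet0
import Summits.KontsevichZagierPeriods.KontsevichZagierPeriods.Theorems.IsogenyCertificatesRichelotChainSheet1
import Summits.KontsevichZagierPeriods.KontsevichZagierPeriods.Theorems.IsogenyCertificatesRichelotChainSheet2
import Summits.KontsevichZagierPeriods.KontsevichZagierPeriods.Theorems.IsogenyCertificatesRichelotChainSheet3
import Summits.KontsevichZagierPeriods.KontsevichZagierPeriods.Theorems.IsogenyCertificatesRichelotChainSheet4

/-!
# `RichelotChain` (stmt-KontsevichZagierPeriods-6732, route IsogenyCertificates): the typed statement, proved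

The genus-2 calibration of the route: an explicit Richelot pair with all twelve Weierstrass points
rational and both sextics monic,

* `C : y² = F(x) = x(x−6)(x−13)(x−30)(x−40)(x−45)`, quadratic splitting `G₁ = x(x−45)`,
  `G₂ = (x−6)(x−13)`, `G₃ = (x−30)(x−40)`;
* `Ĉ : w² = F̂(z) = L₁L₂L₃/Δ = (z+15)(z−9)(z−10)(z−34)(z−36)(z−60)`
  (`Lᵢ = G′ⱼGₖ − GⱼG′ₖ`, `Δ = −33150`; Bost–Mestre 1988 §2, Cassels–Flynn 1996 ch. 9),

and the theorem that for every `k < 5` and all rational `α, β` the real root-interval integral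
`∫ (α+βz) dz/√|F̂|` over the `k`-th bounded root interval of `Ĉ` is KZ-EQUIVALENT (reachable by
Kontsevich–Zagier's rules (1), (2) alone — no Stokes) to `q_k ∫ (α+βx) dx/√|F|` over the `k`-th
bounded root interval of `C`, `q = (1, ½, 1, ½, 1)`:
`(−15,9) ↔ (0,6)`, `(9,10) ↔ (6,13)`, `(10,34) ↔ (13,30)`, `(34,36) ↔ (30,40)`, `(36,60) ↔ (40,45)`
(the intervals where `F̂, F < 0` transfer with factor `1`, the real ovals with factor `2`: the
Richelot isogeny has kernel `(ℤ/2)²`). Each case is six moves along the two real sheets of one of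
Richelot's (2,2)-correspondences (`…Sheet0`–`…Sheet4`, engine `correspondence_transfer`). The item
is informal on the ledger at the time of writing; `richelotChain_typed` is the statement proposed
for it (session evidence `evidence-richelot-instance.md`), so that the route declaration, once
set to this `Prop`, is closed by `exact richelotChain_typed`. Numerical cross-check of the period
table to 80 digits: kit job j014323.

References: J.-B. Bost, J.-F. Mestre, *Moyenne arithmético-géométrique et périodes des courbes de
genre 1 et 2*, Gaz. Math. 38 (1988), §2; J. W. S. Cassels, E. V. Flynn, *Prolegomena to a middlebrow
arithmetic of curves of genus 2* (1996), ch. 9; M. Kontsevich, D. Zagier, *Periods* (2001), §1.2.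
-/

noncomputable section

open Set
open Literature.NumberTheory.Transcendental

namespace Summit.KontsevichZagierPeriods.IsogenyCertificates.RichelotChain

/-- **`RichelotChain` (typed form).** For `k : Fin 5`, `α β : ℚ` and one-dimensional integral
representations `r = [(ĉ_k, ĉ_{k+1}), (α+βz)/√|F̂(z)|]`, `r' = [(c_k, c_{k+1}), q_k(α+βx)/√|F(x)|]`
(`ĉ = (−15,9,10,34,36,60)`, `c = (0,6,13,30,40,45)`, `q = (1,½,1,½,1)`,
`F̂ = (z+15)(z−9)(z−10)(z−34)(z−36)(z−60)`, `F = x(x−6)(x−13)(x−30)(x−40)(x−45)`), `r` and `r'` are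
equivalent in the Kontsevich–Zagier calculus. [cite: BostMestre1988, §2] -/
theorem richelotChain_typed :
    ∀ (k : Fin 5) (α β : ℚ) (r r' : Literature.NumberTheory.Transcendental.KZ.IntegralRep 1),
      r.domain = {z | (![-15, 9, 10, 34, 36] k : ℝ) < z 0 ∧ z 0 < (![9, 10, 34, 36, 60] k : ℝ)} →
      Set.EqOn r.integrand (fun z => ((α : ℝ) + (β : ℝ) * z 0) /
        Real.sqrt |(z 0 + 15) * (z 0 - 9) * (z 0 - 10) * (z 0 - 34) * (z 0 - 36) * (z 0 - 60)|) r.domain →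
      r'.domain = {x | (![0, 6, 13, 30, 40] k : ℝ) < x 0 ∧ x 0 < (![6, 13, 30, 40, 45] k : ℝ)} →
      Set.EqOn r'.integrand (fun x => (![1, 1 / 2, 1, 1 / 2, 1] k : ℝ) * ((α : ℝ) + (β : ℝ) * x 0) /
        Real.sqrt |x 0 * (x 0 - 6) * (x 0 - 13) * (x 0 - 30) * (x 0 - 40) * (x 0 - 45)|) r'.domain →
      Literature.NumberTheory.Transcendental.KZ.Equivalent r r' := by
  intro k α β r r' h1 h2 h3 h4
  fin_cases k
  · exact sheet_k0 α β r r' h1 h2 h3 h4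
  · exact sheet_k1 α β r r' h1 h2 h3 h4
  · exact sheet_k2 α β r r' h1 h2 h3 h4
  · exact sheet_k3 α β r r' h1 h2 h3 h4
  · exact sheet_k4 α β r r' h1 h2 h3 h4

end Summit.KontsevichZagierPeriods.IsogenyCertificates.RichelotChain

end
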